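import Summits.QuantumFields.QCD.Theorems.WilsonMobilityGapMobilityGapStubLightMoment
import Summits.QuantumFields.QCD.Theorems.WilsonMobilityGapMobilityGapPinchWard
import Summits.QuantumFields.QCD.Theorems.TiltedFlatness.Negative.MasslessKernel
import Literature.Barriers.QuantumFields.WilsonDeterminantSign

/-!
# Crux `MobilityGap` (stmt-QuantumFields-9150), line `Ideator6Sketch` (card `integer-pinch-unitary-point`) —
# the twisted Ward sum rule in RESOLVENT FORM, the `1/ω²` bound, and the AVERAGED sum rule
# (helper file, `--supports` 9150; fragments (a), (b) of stub `stub_aokiLRO`, S3 of the line)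

Stub `stub_aokiLRO` (S3) must turn delocalisation of the Hermitian Wilson–Dirac kernel `H_W = Γ₅ D_W(x)` at a
unitary (Aoki) point into long-range order of the phase-quenched second moment `fm … 2`.  Its conversion tool
is the exact twisted Ward sum rule `ω Σ_q |A_ω⁻¹(p,q)|² = -Im (A_ω⁻¹Γ₅)(p,p)`, `A_ω = D_W(U,x,1) + iωΓ₅`
(landed: `twistedWardSumRule_wilson`, `…PinchWard.lean`).  This file records, kernel-checked, WHAT that
identity is and what it is not:

* §1 (abstract, any `Γ`-Hermitian `D` with `Γ` a Hermitian involution, `H = ΓD`, real `ω`):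
  `A_ω = Γ (H + iω)` (`twist_eq_mul`), Pythagoras `‖(H+iω)u‖² = ‖Hu‖² + ω²‖u‖²` (`twist_mulVec_norm_sq`),
  hence `H + iω` is invertible for `ω ≠ 0` (`isUnit_twist`) with the RESOLVENT BOUND
  `‖(H+iω)⁻¹v‖ ≤ ‖v‖/|ω|` (`twist_inv_mulVec_norm_sq_le`), the matrix identity
  `A_ω⁻¹ (A_ω⁻¹)ᴴ = (H² + ω²)⁻¹` (`inv_twist_mul_conjTranspose_inv_twist`, every real `ω`, Mathlib inverses),
  its diagonal `Σ_q |A_ω⁻¹(p,q)|² = ((H²+ω²)⁻¹)(p,p)` (`sum_norm_sq_inv_twist_eq`), and the uniform bounds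
  `Σ_q |A_ω⁻¹(p,q)|² ≤ 1/ω²`, `|(A_ω⁻¹Γ)(p,p)| ≤ 1/|ω|` (`sum_norm_sq_inv_twist_le`, `norm_inv_twist_mul_apply_le`).
* §2 (Wilson/SU(3), every torus, every field, every bare mass): FRAGMENT (a) `resolventSumRule_wilson` —
  `Σ_q |A_ω⁻¹(p,q)|² = ((H_W² + ω²)⁻¹)(p,p)` with `H_W = hermitianWilsonDirac` — so the landed sum rule is the
  resolvent identity `-Im (H_W+iω)⁻¹(p,p) = ω (H_W²+ω²)⁻¹(p,p)`; at `ω = 0` it is only the finite-volume ROW-SUM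
  statement `Σ_q |D_W⁻¹(p,q)|² = (H_W⁻²)(p,p)` (`sum_norm_sq_inv_wilsonDirac_eq`), which says nothing about an
  individual separation `n` — the pointwise-in-`n` lower bound of S3 needs genuinely more (long-range ORDER of
  the condensate two-point function).  Bounds `sum_norm_sq_twistedInv_le_wilson`, `norm_twistedCondensate_le_wilson`.
* §3 FRAGMENT (b) `twistedWardSumRule_averaged` — measurability of the twisted propagator entries in the gauge
  field, integrability of both sides of the sum rule against every finite gauge-field measure (`ω ≠ 0`), and the
  sum rule AVERAGED under the phase-quenched lattice-QCD probability measure `qcdLatticeMeasure (2S+1) β mq`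
  (any sea tuple; the stub's measure is the degenerate sea `mq = (x,…,x)`): "twisted mass × averaged charged
  susceptibility = averaged twisted condensate", with the averaged susceptibility `≤ 1/ω²`.  This is the exact
  lattice Goldstone / Banks–Casher identity for the Aoki order parameter `⟨ψ̄ iγ₅τ³ ψ⟩`; it converts a ONE-point
  order parameter bounded below (as `ω → 0` after the volume) into two-point REACH of the twisted propagator,
  with no reflection positivity.  Not supplied here (nor by any tree/literature input, as typed): the order
  parameter's lower bound, the `ω → 0`/volume interchange, the Cesàro-to-pointwise step (g2) of the card.
-/

noncomputable section

namespace Summit.QuantumFields.QCD.Theorems.MobilityGapPinch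

open scoped BigOperators Topology ComplexConjugate
open MeasureTheory Filter Set Matrix Complex
open Literature.MathematicalPhysics.QuantumFieldTheory Literature.MathematicalPhysics.QuantumLattice
  Literature.Probability.LatticeModels Literature.Barriers.QuantumFields.WilsonDeterminant
open Summit.QuantumFields.QCD.Theorems.MobilityGapSketch
open Summit.QuantumFields.QCD.Theorems.TiltedFlatnessNegative (star_dotProduct_self_eq)

/-! ### §1 Abstract matrix facts: the twisted resolvent `H + iω` of a Hermitian `H` -/

section Abstract

variable {n : Type*} [Fintype n] [DecidableEq n]

omit [DecidableEq n] in
/-- The diagonal entries of `X Xᴴ` are the squared row norms: `(X Xᴴ)(p,p) = Σ_q ‖X(p,q)‖²`. -/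
theorem mul_conjTranspose_self_apply (X : Matrix n n ℂ) (p : n) :
    (X * Xᴴ) p p = ((∑ q, ‖X p q‖ ^ 2 : ℝ) : ℂ) := by
  rw [Matrix.mul_apply, Complex.ofReal_sum]
  refine Finset.sum_congr rfl fun q _ => ?_
  rw [conjTranspose_apply, Complex.star_def, ← Complex.normSq_eq_norm_sq, ← Complex.mul_conj]

/-- `star (ω i) = -(ω i)` for real `ω`. -/
theorem star_ofReal_mul_I (ω : ℝ) : star ((ω : ℂ) * I) = -((ω : ℂ) * I) := by
  rw [Complex.star_def, map_mul, Complex.conj_ofReal, Complex.conj_I]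
  ring

/-- **Pythagoras for the twisted resolvent.** For a Hermitian `H`, a real `ω` and any vector `u`:
`‖(H + iω)u‖² = ‖Hu‖² + ω²‖u‖²` (the cross terms `±iω⟨u,Hu⟩` cancel because `⟨u,Hu⟩` is real). -/
theorem twist_mulVec_norm_sq {H : Matrix n n ℂ} (hH : H.IsHermitian) (ω : ℝ) (u : n → ℂ) :
    ∑ i, ‖((H + ((ω : ℂ) * I) • (1 : Matrix n n ℂ)) *ᵥ u) i‖ ^ 2 =
      ∑ i, ‖(H *ᵥ u) i‖ ^ 2 + ω ^ 2 * ∑ i, ‖u i‖ ^ 2 := by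
  have h1 : (H + ((ω : ℂ) * I) • (1 : Matrix n n ℂ)) *ᵥ u = H *ᵥ u + ((ω : ℂ) * I) • u := by
    rw [add_mulVec, smul_mulVec, one_mulVec]
  have hcross : star (H *ᵥ u) ⬝ᵥ u = star u ⬝ᵥ (H *ᵥ u) := by
    rw [star_mulVec, hH.eq, ← dotProduct_mulVec]
  apply Complex.ofReal_injective
  rw [← star_dotProduct_self_eq, h1, Complex.ofReal_add, Complex.ofReal_mul,
    ← star_dotProduct_self_eq, ← star_dotProduct_self_eq, star_add, star_smul,
    star_ofReal_mul_I, add_dotProduct, dotProduct_add, dotProduct_add, smul_dotProduct,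
    smul_dotProduct, dotProduct_smul, dotProduct_smul, hcross, smul_eq_mul, smul_eq_mul, smul_eq_mul,
    smul_eq_mul]
  push_cast
  linear_combination (-(ω : ℂ) ^ 2 * (star u ⬝ᵥ u)) * Complex.I_mul_I

/-- The twisted resolvent `H + iω` of a Hermitian `H` is invertible for `ω ≠ 0`. -/
theorem isUnit_twist {H : Matrix n n ℂ} (hH : H.IsHermitian) {ω : ℝ} (hω : ω ≠ 0) :
    IsUnit (H + ((ω : ℂ) * I) • (1 : Matrix n n ℂ)) := by
  refine (Matrix.mulVec_injective_iff_isUnit).1 fun v w hvw => ?_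
  have h0 : (H + ((ω : ℂ) * I) • (1 : Matrix n n ℂ)) *ᵥ (v - w) = 0 := by
    rw [mulVec_sub, hvw, sub_self]
  have h := twist_mulVec_norm_sq hH ω (v - w)
  rw [h0] at h
  simp only [Pi.zero_apply, norm_zero, ne_eq, OfNat.ofNat_ne_zero, not_false_eq_true, zero_pow,
    Finset.sum_const_zero] at h
  have hA : 0 ≤ ∑ i, ‖(H *ᵥ (v - w)) i‖ ^ 2 := Finset.sum_nonneg fun i _ => by positivity
  have hS0 : 0 ≤ ∑ i, ‖(v - w) i‖ ^ 2 := Finset.sum_nonneg fun i _ => by positivity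
  have hω2 : 0 < ω ^ 2 := by positivity
  have hS : ∑ i, ‖(v - w) i‖ ^ 2 = 0 := by nlinarith
  rw [Finset.sum_eq_zero_iff_of_nonneg fun i _ => by positivity] at hS
  exact sub_eq_zero.1 (funext fun i => by simpa using hS i (Finset.mem_univ i))

/-- **Resolvent bound** `‖(H + iω)⁻¹ v‖ ≤ ‖v‖/|ω|` (squared form) for a Hermitian `H` and `ω ≠ 0`. -/
theorem twist_inv_mulVec_norm_sq_le {H : Matrix n n ℂ} (hH : H.IsHermitian) {ω : ℝ} (hω : ω ≠ 0)
    (v : n → ℂ) :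
    ∑ i, ‖((H + ((ω : ℂ) * I) • (1 : Matrix n n ℂ))⁻¹ *ᵥ v) i‖ ^ 2 ≤ (1 / ω ^ 2) * ∑ i, ‖v i‖ ^ 2 := by
  set B : Matrix n n ℂ := H + ((ω : ℂ) * I) • (1 : Matrix n n ℂ) with hB
  set u : n → ℂ := B⁻¹ *ᵥ v with hu
  have hBu : B *ᵥ u = v := by
    rw [hu, mulVec_mulVec, mul_nonsing_inv _ ((isUnit_iff_isUnit_det _).1 (isUnit_twist hH hω)),
      one_mulVec]
  have h := twist_mulVec_norm_sq hH ω u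
  rw [← hB, hBu] at h
  have hA : 0 ≤ ∑ i, ‖(H *ᵥ u) i‖ ^ 2 := Finset.sum_nonneg fun i _ => by positivity
  have hω2 : 0 < ω ^ 2 := by positivity
  rw [one_div_mul_eq_div, le_div_iff₀ hω2]
  nlinarith

/-- **Row bound for the twisted resolvent**: `Σ_q ‖(H + iω)⁻¹(p,q)‖² ≤ 1/ω²` for a Hermitian `H`,
`ω ≠ 0` (row `p` of `(H+iω)⁻¹` is the conjugate of column `p` of `(H-iω)⁻¹`). -/
theorem sum_norm_sq_twist_inv_row_le {H : Matrix n n ℂ} (hH : H.IsHermitian) {ω : ℝ} (hω : ω ≠ 0)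
    (p : n) :
    ∑ q, ‖(H + ((ω : ℂ) * I) • (1 : Matrix n n ℂ))⁻¹ p q‖ ^ 2 ≤ 1 / ω ^ 2 := by
  have hBH : (H + ((ω : ℂ) * I) • (1 : Matrix n n ℂ))ᴴ =
      H + ((((-ω : ℝ)) : ℂ) * I) • (1 : Matrix n n ℂ) := by
    rw [conjTranspose_add, conjTranspose_smul, conjTranspose_one, hH.eq, star_ofReal_mul_I]
    push_cast
    ring_nf
  have hcol : ∀ q, (H + ((ω : ℂ) * I) • (1 : Matrix n n ℂ))⁻¹ p q =
      star (((H + (((-ω : ℝ) : ℂ) * I) • (1 : Matrix n n ℂ))⁻¹ *ᵥ (Pi.single p 1)) q) := by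
    intro q
    rw [← hBH, ← conjTranspose_nonsing_inv, mulVec_single_one]
    simp [Matrix.col, conjTranspose_apply]
  have hω' : -ω ≠ 0 := neg_ne_zero.2 hω
  calc ∑ q, ‖(H + ((ω : ℂ) * I) • (1 : Matrix n n ℂ))⁻¹ p q‖ ^ 2
      = ∑ q, ‖(((H + (((-ω : ℝ) : ℂ) * I) • (1 : Matrix n n ℂ))⁻¹ *ᵥ (Pi.single p 1)) q)‖ ^ 2 := by
        refine Finset.sum_congr rfl fun q _ => ?_
        rw [hcol q, norm_star]
    _ ≤ (1 / (-ω) ^ 2) * ∑ q, ‖(Pi.single p (1 : ℂ) : n → ℂ) q‖ ^ 2 :=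
        twist_inv_mulVec_norm_sq_le hH hω' _
    _ = 1 / ω ^ 2 := by
        rw [Finset.sum_eq_single p (fun q _ hq => by simp [hq])
          (fun h => absurd (Finset.mem_univ p) h)]
        simp

/-- `(H - iω)(H + iω) = H² + ω²` for a Hermitian `H`. -/
theorem conjTranspose_twist_mul_twist {H : Matrix n n ℂ} (hH : H.IsHermitian) (ω : ℝ) :
    (H + ((ω : ℂ) * I) • (1 : Matrix n n ℂ))ᴴ * (H + ((ω : ℂ) * I) • (1 : Matrix n n ℂ)) =
      H * H + ((ω ^ 2 : ℝ) : ℂ) • (1 : Matrix n n ℂ) := by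
  rw [conjTranspose_add, conjTranspose_smul, conjTranspose_one, hH.eq, star_ofReal_mul_I,
    Matrix.add_mul, Matrix.mul_add, Matrix.mul_add, Matrix.mul_smul, Matrix.mul_one, Matrix.smul_mul,
    Matrix.one_mul, Matrix.smul_mul, Matrix.one_mul, smul_smul]
  have hc2 : -((ω : ℂ) * I) * ((ω : ℂ) * I) = ((ω ^ 2 : ℝ) : ℂ) := by
    push_cast
    linear_combination (-(ω : ℂ) ^ 2) * Complex.I_mul_I
  rw [hc2, neg_smul]
  abel

variable (D Γ : Matrix n n ℂ)

/-- `D + cΓ = Γ (ΓD + c)` for an involution `Γ`. -/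
theorem twist_eq_mul (hΓ2 : Γ * Γ = 1) (c : ℂ) :
    D + c • Γ = Γ * (Γ * D + c • (1 : Matrix n n ℂ)) := by
  rw [Matrix.mul_add, ← Matrix.mul_assoc, hΓ2, Matrix.one_mul, Matrix.mul_smul, Matrix.mul_one]

/-- `(D + cΓ)⁻¹ = (ΓD + c)⁻¹ Γ` for an involution `Γ` (Mathlib's `Matrix.inv`; unconditional). -/
theorem inv_twist_eq (hΓ2 : Γ * Γ = 1) (c : ℂ) :
    (D + c • Γ)⁻¹ = (Γ * D + c • (1 : Matrix n n ℂ))⁻¹ * Γ := by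
  rw [twist_eq_mul D Γ hΓ2 c, Matrix.mul_inv_rev, inv_eq_left_inv hΓ2]

/-- `H = ΓD` is Hermitian when `Γ` is a Hermitian involution and `Γ D Γ = Dᴴ`. -/
theorem isHermitian_mul_of_conj (hΓ : Γᴴ = Γ) (hΓ2 : Γ * Γ = 1) (hD : Γ * D * Γ = Dᴴ) :
    (Γ * D).IsHermitian := by
  show (Γ * D)ᴴ = Γ * D
  rw [conjTranspose_mul, hΓ, ← hD, Matrix.mul_assoc, Matrix.mul_assoc, hΓ2, Matrix.mul_one]

/-- `X Xᴴ = B⁻¹ (B⁻¹)ᴴ` for `X = (D + cΓ)⁻¹`, `B = ΓD + c`, `Γ` a Hermitian involution. -/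
theorem inv_twist_mul_conjTranspose_eq (hΓ : Γᴴ = Γ) (hΓ2 : Γ * Γ = 1) (c : ℂ) :
    (D + c • Γ)⁻¹ * ((D + c • Γ)⁻¹)ᴴ =
      (Γ * D + c • (1 : Matrix n n ℂ))⁻¹ * ((Γ * D + c • (1 : Matrix n n ℂ))⁻¹)ᴴ := by
  rw [inv_twist_eq D Γ hΓ2 c, conjTranspose_mul, hΓ, Matrix.mul_assoc, ← Matrix.mul_assoc Γ Γ, hΓ2,
    Matrix.one_mul]

/-- **The resolvent identity behind the twisted Ward sum rule (abstract).** For a `Γ`-Hermitian `D`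
(`Γ D Γ = Dᴴ`, `Γ` a Hermitian involution), `H = ΓD` and a real `ω`, with `A = D + iωΓ`:
`A⁻¹ (A⁻¹)ᴴ = (H² + ω²)⁻¹` (Mathlib inverses throughout; for `ω = 0` and singular `D` both sides
vanish). -/
theorem inv_twist_mul_conjTranspose_inv_twist (hΓ : Γᴴ = Γ) (hΓ2 : Γ * Γ = 1) (hD : Γ * D * Γ = Dᴴ)
    (ω : ℝ) :
    (D + ((ω : ℂ) * I) • Γ)⁻¹ * ((D + ((ω : ℂ) * I) • Γ)⁻¹)ᴴ =
      (Γ * D * (Γ * D) + ((ω ^ 2 : ℝ) : ℂ) • (1 : Matrix n n ℂ))⁻¹ := by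
  rw [inv_twist_mul_conjTranspose_eq D Γ hΓ hΓ2, conjTranspose_nonsing_inv, ← Matrix.mul_inv_rev,
    conjTranspose_twist_mul_twist (isHermitian_mul_of_conj D Γ hΓ hΓ2 hD) ω]

/-- **Row sums of `|A⁻¹|²` are diagonal entries of `(H² + ω²)⁻¹`**:
`Σ_q |A⁻¹(p,q)|² = ((H² + ω²)⁻¹)(p,p)`, `A = D + iωΓ`, `H = ΓD` (every real `ω`). -/
theorem sum_norm_sq_inv_twist_eq (hΓ : Γᴴ = Γ) (hΓ2 : Γ * Γ = 1) (hD : Γ * D * Γ = Dᴴ) (ω : ℝ)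
    (p : n) :
    ((∑ q, ‖(D + ((ω : ℂ) * I) • Γ)⁻¹ p q‖ ^ 2 : ℝ) : ℂ) =
      (Γ * D * (Γ * D) + ((ω ^ 2 : ℝ) : ℂ) • (1 : Matrix n n ℂ))⁻¹ p p := by
  rw [← mul_conjTranspose_self_apply, inv_twist_mul_conjTranspose_inv_twist D Γ hΓ hΓ2 hD ω]

/-- **Row bound**: `Σ_q |A⁻¹(p,q)|² ≤ 1/ω²` for `A = D + iωΓ`, `ω ≠ 0`. -/
theorem sum_norm_sq_inv_twist_le (hΓ : Γᴴ = Γ) (hΓ2 : Γ * Γ = 1) (hD : Γ * D * Γ = Dᴴ) {ω : ℝ}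
    (hω : ω ≠ 0) (p : n) :
    ∑ q, ‖(D + ((ω : ℂ) * I) • Γ)⁻¹ p q‖ ^ 2 ≤ 1 / ω ^ 2 := by
  have h := congrFun (congrFun (inv_twist_mul_conjTranspose_eq D Γ hΓ hΓ2 ((ω : ℂ) * I)) p) p
  rw [mul_conjTranspose_self_apply, mul_conjTranspose_self_apply] at h
  rw [Complex.ofReal_injective h]
  exact sum_norm_sq_twist_inv_row_le (isHermitian_mul_of_conj D Γ hΓ hΓ2 hD) hω p

/-- **The twisted condensate is bounded**: `|(A⁻¹Γ)(p,p)| ≤ 1/|ω|` (`(A⁻¹Γ) = (H+iω)⁻¹`). -/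
theorem norm_inv_twist_mul_apply_le (hΓ : Γᴴ = Γ) (hΓ2 : Γ * Γ = 1) (hD : Γ * D * Γ = Dᴴ) {ω : ℝ}
    (hω : ω ≠ 0) (p : n) :
    ‖((D + ((ω : ℂ) * I) • Γ)⁻¹ * Γ) p p‖ ≤ 1 / |ω| := by
  rw [inv_twist_eq D Γ hΓ2, Matrix.mul_assoc, hΓ2, Matrix.mul_one]
  have hH := isHermitian_mul_of_conj D Γ hΓ hΓ2 hD
  have hrow := sum_norm_sq_twist_inv_row_le hH hω p
  have hle : ‖(Γ * D + ((ω : ℂ) * I) • (1 : Matrix n n ℂ))⁻¹ p p‖ ^ 2 ≤ 1 / ω ^ 2 :=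
    (Finset.single_le_sum (f := fun q => ‖(Γ * D + ((ω : ℂ) * I) • (1 : Matrix n n ℂ))⁻¹ p q‖ ^ 2)
      (fun q _ => by positivity) (Finset.mem_univ p)).trans hrow
  have h1 : (1 / ω ^ 2 : ℝ) = (1 / |ω|) ^ 2 := by rw [div_pow, one_pow, sq_abs]
  rw [h1] at hle
  exact (abs_le_of_sq_le_sq' hle (by positivity)).2

end Abstract

/-! ### §2 The Wilson instance: `A_ω = D_W(U,x,1) + iωΓ₅`, `H_W = Γ₅ D_W(U,x,1)` (`hermitianWilsonDirac`) -/

section Wilson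

/-- **Fragment (a) — the resolvent form of the twisted Ward sum rule, Wilson/SU(3).** For every
`SU(3)` lattice gauge field `U` on any four-torus, every real bare mass `x`, EVERY real twist `ω`
and every quark index `p`, with `A_ω = D_W(U,x,1) + iωΓ₅` and the Hermitian Wilson–Dirac operator
`H_W = Γ₅ D_W(U,x,1)`:  `Σ_q |A_ω⁻¹(p,q)|² = ((H_W² + ω²)⁻¹)(p,p)`.  So the charged (row)
susceptibility of the twisted propagator IS the diagonal of the squared-resolvent `(H_W² + ω²)⁻¹`,
and the landed sum rule `ω Σ_q|A_ω⁻¹(p,q)|² = -Im(A_ω⁻¹Γ₅)(p,p)` is the resolvent identity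
`-Im (H_W+iω)⁻¹(p,p) = ω (H_W²+ω²)⁻¹(p,p)`.  At `ω = 0` (below) it degenerates to the finite-volume
statement `Σ_q |D_W⁻¹(p,q)|² = (H_W⁻²)(p,p)` about the ROW SUM only. -/
theorem resolventSumRule_wilson : ∀ {L : ℕ} [NeZero L] (U : GaugeConfig 4 L (Matrix.specialUnitaryGroup (Fin 3) ℂ)) (x ω : ℝ) (p : TorusSite 4 L × Fin 3 × Fin 4), ∑ q, ‖(wilsonDirac (fundamentalRep (Fin 3)) U x 1 + ((ω : ℂ) * Complex.I) • (spinorLift gammaFive : Matrix (TorusSite 4 L × Fin 3 × Fin 4) (TorusSite 4 L × Fin 3 × Fin 4) ℂ))⁻¹ p q‖ ^ 2 = ((hermitianWilsonDirac (fundamentalRep (Fin 3)) U x 1 * hermitianWilsonDirac (fundamentalRep (Fin 3)) U x 1 + ((ω ^ 2 : ℝ) : ℂ) • (1 : Matrix (TorusSite 4 L × Fin 3 × Fin 4) (TorusSite 4 L × Fin 3 × Fin 4) ℂ))⁻¹ p p).re := by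
  intro L _ U x ω p
  have h : ((∑ q, ‖(wilsonDirac (fundamentalRep (Fin 3)) U x 1 + ((ω : ℂ) * Complex.I) •
      (spinorLift gammaFive : Matrix (TorusSite 4 L × Fin 3 × Fin 4) (TorusSite 4 L × Fin 3 × Fin 4) ℂ))⁻¹
        p q‖ ^ 2 : ℝ) : ℂ) =
      (hermitianWilsonDirac (fundamentalRep (Fin 3)) U x 1 * hermitianWilsonDirac (fundamentalRep (Fin 3)) U x 1 +
        ((ω ^ 2 : ℝ) : ℂ) • (1 : Matrix (TorusSite 4 L × Fin 3 × Fin 4) (TorusSite 4 L × Fin 3 × Fin 4) ℂ))⁻¹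
          p p :=
    sum_norm_sq_inv_twist_eq (wilsonDirac (fundamentalRep (Fin 3)) U x 1)
      (spinorLift gammaFive) conjTranspose_spinorLift_gammaFive spinorLift_gammaFive_mul_self
      (wilsonDirac_gammaFive_hermitian_holds (fundamentalRep (Fin 3)) fundamentalRep_mem_unitaryGroup U x 1) ω p
  rw [← h, Complex.ofReal_re]

/-- The `ω = 0` case: `Σ_q |D_W(U,x,1)⁻¹(p,q)|² = ((H_W²)⁻¹)(p,p)` — the row sum of the squared
propagator moduli over ALL sinks is the diagonal of `H_W⁻²` (both sides `0` where `D_W` is singular,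
Mathlib's inverse).  A statement about the row sum, not about individual separations. -/
theorem sum_norm_sq_inv_wilsonDirac_eq {L : ℕ} [NeZero L]
    (U : GaugeConfig 4 L (Matrix.specialUnitaryGroup (Fin 3) ℂ)) (x : ℝ) (p : TorusSite 4 L × Fin 3 × Fin 4) :
    ∑ q, ‖(wilsonDirac (fundamentalRep (Fin 3)) U x 1)⁻¹ p q‖ ^ 2 =
      ((hermitianWilsonDirac (fundamentalRep (Fin 3)) U x 1 *
        hermitianWilsonDirac (fundamentalRep (Fin 3)) U x 1)⁻¹ p p).re := by
  simpa using resolventSumRule_wilson U x 0 p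

/-- **The `1/ω²` bound** (uniform in the gauge field, the volume and the mass):
`Σ_q |A_ω⁻¹(p,q)|² ≤ 1/ω²` for `ω ≠ 0` (`H_W` is Hermitian, so `‖(H_W + iω)⁻¹‖ ≤ 1/|ω|`). -/
theorem sum_norm_sq_twistedInv_le_wilson {L : ℕ} [NeZero L]
    (U : GaugeConfig 4 L (Matrix.specialUnitaryGroup (Fin 3) ℂ)) (x : ℝ) {ω : ℝ} (hω : ω ≠ 0)
    (p : TorusSite 4 L × Fin 3 × Fin 4) :
    ∑ q, ‖(wilsonDirac (fundamentalRep (Fin 3)) U x 1 + ((ω : ℂ) * Complex.I) •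
        (spinorLift gammaFive : Matrix (TorusSite 4 L × Fin 3 × Fin 4)
          (TorusSite 4 L × Fin 3 × Fin 4) ℂ))⁻¹ p q‖ ^ 2 ≤ 1 / ω ^ 2 :=
  sum_norm_sq_inv_twist_le _ _ conjTranspose_spinorLift_gammaFive spinorLift_gammaFive_mul_self
    (wilsonDirac_gammaFive_hermitian_holds (fundamentalRep (Fin 3)) fundamentalRep_mem_unitaryGroup U x 1)
    hω p

/-- **The twisted condensate is bounded**: `|(A_ω⁻¹Γ₅)(p,p)| ≤ 1/|ω|` for `ω ≠ 0`, every field. -/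
theorem norm_twistedCondensate_le_wilson {L : ℕ} [NeZero L]
    (U : GaugeConfig 4 L (Matrix.specialUnitaryGroup (Fin 3) ℂ)) (x : ℝ) {ω : ℝ} (hω : ω ≠ 0)
    (p : TorusSite 4 L × Fin 3 × Fin 4) :
    ‖((wilsonDirac (fundamentalRep (Fin 3)) U x 1 + ((ω : ℂ) * Complex.I) •
        (spinorLift gammaFive : Matrix (TorusSite 4 L × Fin 3 × Fin 4)
          (TorusSite 4 L × Fin 3 × Fin 4) ℂ))⁻¹ *
        (spinorLift gammaFive : Matrix (TorusSite 4 L × Fin 3 × Fin 4)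
          (TorusSite 4 L × Fin 3 × Fin 4) ℂ)) p p‖ ≤ 1 / |ω| :=
  norm_inv_twist_mul_apply_le _ _ conjTranspose_spinorLift_gammaFive spinorLift_gammaFive_mul_self
    (wilsonDirac_gammaFive_hermitian_holds (fundamentalRep (Fin 3)) fundamentalRep_mem_unitaryGroup U x 1)
    hω p

/-! ### §3 Measurability, integrability and the AVERAGED sum rule -/

/-- The twisted Wilson–Dirac matrix depends continuously on the gauge field. -/
theorem continuous_twistedWilsonDirac {L : ℕ} [NeZero L] (x ω : ℝ) :
    Continuous fun U : GaugeConfig 4 L (Matrix.specialUnitaryGroup (Fin 3) ℂ) =>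
      wilsonDirac (fundamentalRep (Fin 3)) U x 1 + ((ω : ℂ) * Complex.I) •
        (spinorLift gammaFive : Matrix (TorusSite 4 L × Fin 3 × Fin 4)
          (TorusSite 4 L × Fin 3 × Fin 4) ℂ) :=
  (continuous_wilsonDirac (fundamentalRep (Fin 3)) (continuous_fundamentalRep (Fin 3)) x 1).add
    continuous_const

/-- Every entry of the twisted quark propagator `U ↦ A_ω(U)⁻¹(p,q)` is a measurable function of the
gauge field (`A⁻¹ = (det A)⁻¹ adj A`, `det`/`adj` continuous, `z ↦ z⁻¹` measurable). -/
theorem measurable_twistedInv_apply {L : ℕ} [NeZero L] (x ω : ℝ) (p q : TorusSite 4 L × Fin 3 × Fin 4) :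
    Measurable fun U : GaugeConfig 4 L (Matrix.specialUnitaryGroup (Fin 3) ℂ) =>
      (wilsonDirac (fundamentalRep (Fin 3)) U x 1 + ((ω : ℂ) * Complex.I) •
        (spinorLift gammaFive : Matrix (TorusSite 4 L × Fin 3 × Fin 4)
          (TorusSite 4 L × Fin 3 × Fin 4) ℂ))⁻¹ p q := by
  set A : GaugeConfig 4 L (Matrix.specialUnitaryGroup (Fin 3) ℂ) →
      Matrix (TorusSite 4 L × Fin 3 × Fin 4) (TorusSite 4 L × Fin 3 × Fin 4) ℂ :=
    fun U => wilsonDirac (fundamentalRep (Fin 3)) U x 1 + ((ω : ℂ) * Complex.I) •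
      (spinorLift gammaFive : Matrix (TorusSite 4 L × Fin 3 × Fin 4)
        (TorusSite 4 L × Fin 3 × Fin 4) ℂ) with hA
  have hc : Continuous A := continuous_twistedWilsonDirac x ω
  have h1 : (fun U => (A U)⁻¹ p q) = fun U => ((A U).det)⁻¹ * (A U).adjugate p q := by
    funext U
    rw [Matrix.inv_def, Matrix.smul_apply, smul_eq_mul, Ring.inverse_eq_inv']
  show Measurable fun U => (A U)⁻¹ p q
  rw [h1]
  exact hc.matrix_det.measurable.inv.mul ((hc.matrix_adjugate.matrix_elem p q).measurable)

/-- The twisted condensate `U ↦ (A_ω(U)⁻¹ Γ₅)(p,p)` is measurable. -/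
theorem measurable_twistedCondensate {L : ℕ} [NeZero L] (x ω : ℝ) (p : TorusSite 4 L × Fin 3 × Fin 4) :
    Measurable fun U : GaugeConfig 4 L (Matrix.specialUnitaryGroup (Fin 3) ℂ) =>
      ((wilsonDirac (fundamentalRep (Fin 3)) U x 1 + ((ω : ℂ) * Complex.I) •
        (spinorLift gammaFive : Matrix (TorusSite 4 L × Fin 3 × Fin 4)
          (TorusSite 4 L × Fin 3 × Fin 4) ℂ))⁻¹ *
        (spinorLift gammaFive : Matrix (TorusSite 4 L × Fin 3 × Fin 4)
          (TorusSite 4 L × Fin 3 × Fin 4) ℂ)) p p := by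
  simp only [Matrix.mul_apply]
  exact Finset.measurable_sum _ fun q _ => (measurable_twistedInv_apply x ω p q).mul_const _

/-- The charged row susceptibility `U ↦ Σ_q |A_ω(U)⁻¹(p,q)|²` is integrable against every finite
gauge-field measure when `ω ≠ 0` (bounded by `1/ω²`). -/
theorem integrable_sum_norm_sq_twistedInv {L : ℕ} [NeZero L]
    (μ : Measure (GaugeConfig 4 L (Matrix.specialUnitaryGroup (Fin 3) ℂ))) [IsFiniteMeasure μ]
    (x : ℝ) {ω : ℝ} (hω : ω ≠ 0) (p : TorusSite 4 L × Fin 3 × Fin 4) :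
    Integrable (fun U : GaugeConfig 4 L (Matrix.specialUnitaryGroup (Fin 3) ℂ) =>
      ∑ q, ‖(wilsonDirac (fundamentalRep (Fin 3)) U x 1 + ((ω : ℂ) * Complex.I) •
        (spinorLift gammaFive : Matrix (TorusSite 4 L × Fin 3 × Fin 4)
          (TorusSite 4 L × Fin 3 × Fin 4) ℂ))⁻¹ p q‖ ^ 2) μ := by
  refine Integrable.of_bound ?_ (1 / ω ^ 2) (Eventually.of_forall fun U => ?_)
  · exact (Finset.measurable_sum _ fun q _ =>
      ((measurable_twistedInv_apply x ω p q).norm.pow_const 2)).aestronglyMeasurable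
  · rw [Real.norm_eq_abs, abs_of_nonneg (Finset.sum_nonneg fun q _ => by positivity)]
    exact sum_norm_sq_twistedInv_le_wilson U x hω p

/-- The twisted condensate `U ↦ -Im (A_ω(U)⁻¹Γ₅)(p,p)` is integrable against every finite gauge-field
measure when `ω ≠ 0` (bounded by `1/|ω|`). -/
theorem integrable_twistedCondensate {L : ℕ} [NeZero L]
    (μ : Measure (GaugeConfig 4 L (Matrix.specialUnitaryGroup (Fin 3) ℂ))) [IsFiniteMeasure μ]
    (x : ℝ) {ω : ℝ} (hω : ω ≠ 0) (p : TorusSite 4 L × Fin 3 × Fin 4) :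
    Integrable (fun U : GaugeConfig 4 L (Matrix.specialUnitaryGroup (Fin 3) ℂ) =>
      -(((wilsonDirac (fundamentalRep (Fin 3)) U x 1 + ((ω : ℂ) * Complex.I) •
        (spinorLift gammaFive : Matrix (TorusSite 4 L × Fin 3 × Fin 4)
          (TorusSite 4 L × Fin 3 × Fin 4) ℂ))⁻¹ *
        (spinorLift gammaFive : Matrix (TorusSite 4 L × Fin 3 × Fin 4)
          (TorusSite 4 L × Fin 3 × Fin 4) ℂ)) p p).im) μ := by
  refine Integrable.of_bound ?_ (1 / |ω|) (Eventually.of_forall fun U => ?_)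
  · exact (Complex.measurable_im.comp (measurable_twistedCondensate x ω p)).neg.aestronglyMeasurable
  · rw [norm_neg, Real.norm_eq_abs]
    exact (Complex.abs_im_le_norm _).trans (norm_twistedCondensate_le_wilson U x hω p)

/-- **Fragment (b) — the AVERAGED twisted Ward sum rule under the phase-quenched lattice-QCD
measure.**  For every number of sea flavours `N_f`, torus of side `2S+1`, coupling `β`, sea masses
`mq`, valence mass `x`, twist `ω ≠ 0` and quark index `p`, under the phase-quenched probability
measure `μ = qcdLatticeMeasure (2S+1) β mq` (`∝ ∏_f |det D_W(U,m_f,1)| dμ_W`):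
`ω · ∫ Σ_q |A_ω⁻¹(p,q)|² dμ = ∫ -Im(A_ω⁻¹Γ₅)(p,p) dμ` ("twisted mass × charged susceptibility =
twisted condensate", the exact lattice Goldstone/Banks–Casher identity for the Aoki order parameter,
averaged), both integrands are integrable, and the averaged susceptibility is `≤ 1/ω²`.  The
degenerate sea `mq = fun _ => x` is the measure of stub `stub_aokiLRO`. -/
theorem twistedWardSumRule_averaged : ∀ (Nf S : ℕ) (β : ℝ) (mq : Fin Nf → ℝ) (x ω : ℝ), ω ≠ 0 → ∀ p : TorusSite 4 (2 * S + 1) × Fin 3 × Fin 4, ω * (∫ U, ∑ q, ‖(wilsonDirac (fundamentalRep (Fin 3)) U x 1 + ((ω : ℂ) * Complex.I) • (spinorLift gammaFive : Matrix (TorusSite 4 (2 * S + 1) × Fin 3 × Fin 4) (TorusSite 4 (2 * S + 1) × Fin 3 × Fin 4) ℂ))⁻¹ p q‖ ^ 2 ∂(qcdLatticeMeasure (2 * S + 1) β mq)) = ∫ U, -(((wilsonDirac (fundamentalRep (Fin 3)) U x 1 + ((ω : ℂ) * Complex.I) • (spinorLift gammaFive : Matrix (TorusSite 4 (2 * S +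 1) × Fin 3 × Fin 4) (TorusSite 4 (2 * S + 1) × Fin 3 × Fin 4) ℂ))⁻¹ * (spinorLift gammaFive : Matrix (TorusSite 4 (2 * S + 1) × Fin 3 × Fin 4) (TorusSite 4 (2 * S + 1) × Fin 3 × Fin 4) ℂ)) p p).im ∂(qcdLatticeMeasure (2 * S + 1) β mq) ∧ Integrable (fun U => ∑ q, ‖(wilsonDirac (fundamentalRep (Fin 3)) U x 1 + ((ω : ℂ) * Complex.I) • (spinorLift gammaFive : Matrix (TorusSite 4 (2 * S + 1) × Fin 3 × Fin 4) (TorusSite 4 (2 * S + 1) × Fin 3 × Fin 4) ℂ))⁻¹ p q‖ ^ 2) (qcdLatticeMeasure (2 * S + 1) β mq) ∧ Integrable (fun U => -(((wilsonDirac (fundamentalRep (Fin 3)) U x 1 + ((ω : ℂ) * Complex.I) • (spinorLift gammaFive : Matrix (TorusSite 4 (2 * S + 1) × Fin 3 × Fin 4) (TorusSite 4 (2 * S + 1) × Fin 3 × Fin 4) ℂ))⁻¹ * (spinorLift gammaFive : Matrix (TorusSite 4 (2 * S + 1) × Fin 3 × Fin 4) (TorusSite 4 (2 * S + 1) × Fin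 3 × Fin 4) ℂ)) p p).im) (qcdLatticeMeasure (2 * S + 1) β mq) ∧ (∫ U, ∑ q, ‖(wilsonDirac (fundamentalRep (Fin 3)) U x 1 + ((ω : ℂ) * Complex.I) • (spinorLift gammaFive : Matrix (TorusSite 4 (2 * S + 1) × Fin 3 × Fin 4) (TorusSite 4 (2 * S + 1) × Fin 3 × Fin 4) ℂ))⁻¹ p q‖ ^ 2 ∂(qcdLatticeMeasure (2 * S + 1) β mq)) ≤ 1 / ω ^ 2 := by
  intro Nf S β mq x ω hω p
  haveI := isProbabilityMeasure_qcdLatticeMeasure_all (S := 2 * S + 1) β mq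
  refine ⟨?_, integrable_sum_norm_sq_twistedInv _ x hω p, integrable_twistedCondensate _ x hω p, ?_⟩
  · rw [← integral_const_mul]
    exact integral_congr_ae (Eventually.of_forall fun U => twistedWardSumRule_wilson U x ω hω p)
  · calc (∫ U, ∑ q, ‖(wilsonDirac (fundamentalRep (Fin 3)) U x 1 + ((ω : ℂ) * Complex.I) •
            (spinorLift gammaFive : Matrix (TorusSite 4 (2 * S + 1) × Fin 3 × Fin 4)
              (TorusSite 4 (2 * S + 1) × Fin 3 × Fin 4) ℂ))⁻¹ p q‖ ^ 2 ∂(qcdLatticeMeasure (2 * S + 1) β mq))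
        ≤ ∫ _U, (1 / ω ^ 2 : ℝ) ∂(qcdLatticeMeasure (2 * S + 1) β mq) :=
          integral_mono (integrable_sum_norm_sq_twistedInv _ x hω p) (integrable_const _)
            fun U => sum_norm_sq_twistedInv_le_wilson U x hω p
      _ = 1 / ω ^ 2 := by simp

end Wilson

end Summit.QuantumFields.QCD.Theorems.MobilityGapPinch

end
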